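import Summits.Parity.GeneralizedHardyLittlewood.Theorems.GoldbachHeathBrownDispersionHeathBrownMorozUniformClassSV
import Summits.Parity.GeneralizedHardyLittlewood.Theorems.GoldbachHeathBrownDispersionHeathBrownMorozUniformOfTwoClassLemmas
import Literature.NumberTheory.Sieve.HeathBrownCubicTypeIIFinal
import HarnessLib

/-!
# Crux `HeathBrownMorozUniform` (stmt-Parity-19915): the class Type II estimate `h310` PROVED; crux modulo `h39`

Heath-Brown, Acta Math. 186 (2001), Lemma 3.10 (Lemma 12.2 + §13 p. 83 + (13.7)) for the class family
`classPairs X η d a b` of Heath-Brown–Moroz 2004, Prop. 4.2 (ii), with hypothesis (3.14) up to `d·Q₁`: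
the proved glue of the merged skeleton `Cruxes/HeathBrownMorozUniform/Lines/unit_split_positivity.lean`
(Part B: `classSV_le_of_params`, `class_p83`, `class_310`, `h310_of`) instantiated at the three LANDED
Type II stubs `stub_classMainError` (E3), `stub_classMainCauchy` (E4), `stub_twistedSsum` (E5) — copied
letter for letter with the stub hypotheses replaced by the theorems. Result: `class_h310`, literally the
hypothesis `h310` of `heathBrownMorozUniform_of_classLemmas` / `…_of_twoClassLemmas`; hence
`heathBrownMorozUniform_of_h39 : h39 → HeathBrownMorozUniform` — the crux now rests on the class leading
parts `h39` alone (line stubs S3 `stub_sigmaOneCoprime` + S4b `stub_classDisplay104`). Goldbach is not proved by this.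

## References

* D. R. Heath-Brown, Acta Math. 186 (2001), Lemma 3.10, Lemma 12.2, §13 p. 83. [cite: HeathBrownActa2001, Lemma 3.10]
* D. R. Heath-Brown, B. Z. Moroz, Proc. London Math. Soc. 88 (2004), Prop. 4.2 (ii). [cite: HeathBrownMoroz2004, Proposition 4.2]
-/

noncomputable section

open Polynomial NumberField Finset Filter Topology Asymptotics

namespace Summit.Parity.GeneralizedHardyLittlewood.Theorems.GoldbachHeathBrownDispersionHeathBrownMorozUniform

open Literature.NumberTheory.Sieve.CubicSieve Literature.NumberTheory.Sieve.CubicPrimes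
open Literature.NumberTheory.LFunctions.CubeRootTwoField


/-! ### Proved glue: from the three Type II stubs to the class Lemma 3.10 -/

open scoped Classical in
/-- **Class Lemma 3.10 by the choice `Y = Q₁^{1/80}` ((13.7))** — the tree's
`HeathBrown2001_lemma_3_10_of_SV_bound` for the class family, with (3.14) up to `d·Q₁`:
`S_V^{cl} ≪ X² Q₁^{−1/160} (log X)^c`. [cite: HeathBrownActa2001, §13 p. 83, (13.7)] -/
theorem class_310 : ∀ d a₀ b₀ : ℕ, 0 < d → ∀ ϖ : ℝ, 0 < ϖ → ϖ < 1 / 5 →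
    ∃ c c₃ c₄ : ℝ, 0 < c₃ ∧ 0 < c₄ ∧ ∀ C₁ c₁ c₅ c₆ : ℝ, 0 < c₁ → 0 < c₅ → 0 < c₆ →
      ∃ C X₀ : ℝ, ∀ X η Q₁ : ℝ, X₀ ≤ X → Real.exp (-Real.log X ^ (1 / 3 : ℝ)) ≤ η → η ≤ 1 →
        1 ≤ Q₁ → Q₁ ≤ Real.exp (Real.log X ^ (1 / 3 : ℝ)) →
          (∀ (k' : ℕ) (m' : Fin k' → ℕ), CoreAdmissible (hbTau ϖ X) m' →
            Hyp314 X (hbTau ϖ X) m' ((d : ℝ) * Q₁) C₁ c₁ c₃ c₄) →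
            ∀ (k : ℕ) (m : Fin k → ℕ), CoreAdmissible (hbTau ϖ X) m →
              ∀ cR : Ideal (𝓞 K) → ℝ, CSupport X (hbTau ϖ X) cR →
                ∀ V : ℝ, c₅ * X ^ (1 + hbTau ϖ X) ≤ V → V ≤ c₆ * X ^ (3 / 2 - hbTau ϖ X) →
                  |bilin (classPairs X η d a₀ b₀) pairIdeal cR
                      (fun S => if V < (Ideal.absNorm S : ℝ) ∧ (Ideal.absNorm S : ℝ) ≤ 2 * V then
                        fWeight X (hbTau ϖ X) m S else 0)| ≤
                    C * X ^ 2 * Q₁ ^ (-(1 / 160 : ℝ)) * Real.log X ^ c := by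
  intro d a₀ b₀ hd ϖ hϖ0 hϖ5
  obtain ⟨c, c₃, c₄, hc₃, hc₄, H⟩ := class_p83 d a₀ b₀ hd ϖ hϖ0 hϖ5
  refine ⟨c, c₃, c₄, hc₃, hc₄, fun C₁ c₁ c₅ c₆ hc₁ hc₅ hc₆ => ?_⟩
  obtain ⟨C, c₂, X₀, hc₂, HX⟩ := H C₁ c₁ c₅ c₆ hc₁ hc₅ hc₆
  obtain ⟨X₁, hX₁⟩ := Filter.eventually_atTop.mp (eventually_reduction_params ϖ hc₂)
  refine ⟨4 * max C 0, max X₀ X₁,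
    fun X η Q₁ hX hη1 hη2 hQ1 hQ2 hHyp k m hm cR hcR V hV1 hV2 => ?_⟩
  obtain ⟨hX2, hL1, hτpos, hA, hB, hC⟩ := hX₁ X (le_of_max_le_right hX)
  have hXX₀ : X₀ ≤ X := le_of_max_le_left hX
  have hX0 : 0 < X := by linarith
  have hLpos : 0 < Real.log X := by linarith
  have hQpos : 0 < Q₁ := by linarith
  -- the choice `Y = Q₁^{1/80}`
  obtain ⟨Y, hYdef⟩ : ∃ Y : ℝ, Y = Q₁ ^ (1 / 80 : ℝ) := ⟨_, rfl⟩
  have hY1 : 1 ≤ Y := hYdef ▸ Real.one_le_rpow hQ1 (by norm_num)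
  have hYpos : 0 < Y := by linarith
  have hQpow : ∀ a : ℝ, 0 ≤ a → Q₁ ^ a ≤ Real.exp (a * Real.log X ^ (1 / 3 : ℝ)) := by
    intro a ha
    calc Q₁ ^ a ≤ (Real.exp (Real.log X ^ (1 / 3 : ℝ))) ^ a := Real.rpow_le_rpow hQpos.le hQ2 ha
      _ = Real.exp (a * Real.log X ^ (1 / 3 : ℝ)) := by rw [← Real.exp_mul, mul_comm]
  have hXpow : ∀ s : ℝ, X ^ s = Real.exp (s * Real.log X) := fun s => by
    rw [Real.rpow_def_of_pos hX0, mul_comm]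
  have hYX : Y ≤ X ^ (hbTau ϖ X / 3) := by
    calc Y = Q₁ ^ (1 / 80 : ℝ) := hYdef
      _ ≤ Real.exp ((1 / 80) * Real.log X ^ (1 / 3 : ℝ)) := hQpow _ (by norm_num)
      _ ≤ Real.exp (hbTau ϖ X / 3 * Real.log X) :=
          Real.exp_le_exp.mpr (hA.trans_eq (by ring))
      _ = X ^ (hbTau ϖ X / 3) := (hXpow _).symm
  have hmain := HX X η Q₁ Y hXX₀ hη1 hη2 hQ1 hQ2 hY1 hYX hHyp k m hm cR hcR V hV1 hV2
  -- the four terms are each `≤ T = Q₁^{-1/160}`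
  obtain ⟨T, hT⟩ : ∃ T : ℝ, T = Q₁ ^ (-(1 / 160 : ℝ)) := ⟨_, rfl⟩
  have hTpos : 0 < T := hT ▸ Real.rpow_pos_of_pos hQpos _
  have h1 : Y ^ (-(1 / 2 : ℝ)) = T := by
    rw [hYdef, hT, ← Real.rpow_mul hQpos.le]; norm_num
  have h2 : Y ^ 30 * X ^ (-(hbTau ϖ X / 4)) ≤ T := by
    have e1 : Y ^ 30 = Q₁ ^ (3 / 8 : ℝ) := by
      rw [hYdef, ← Real.rpow_natCast, ← Real.rpow_mul hQpos.le]; norm_num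
    have e2 : Q₁ ^ (3 / 8 : ℝ) = T * Q₁ ^ (61 / 160 : ℝ) := by
      rw [hT, ← Real.rpow_add hQpos]; norm_num
    have e3 : Q₁ ^ (61 / 160 : ℝ) ≤ X ^ (hbTau ϖ X / 4) := by
      calc Q₁ ^ (61 / 160 : ℝ) ≤ Real.exp ((61 / 160) * Real.log X ^ (1 / 3 : ℝ)) :=
            hQpow _ (by norm_num)
        _ ≤ Real.exp (hbTau ϖ X / 4 * Real.log X) :=
            Real.exp_le_exp.mpr (hB.trans_eq (by ring))
        _ = X ^ (hbTau ϖ X / 4) := (hXpow _).symm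
    have hXτ : 0 < X ^ (hbTau ϖ X / 4) := Real.rpow_pos_of_pos hX0 _
    rw [e1, e2, Real.rpow_neg hX0.le, mul_assoc]
    calc T * (Q₁ ^ (61 / 160 : ℝ) * (X ^ (hbTau ϖ X / 4))⁻¹) ≤ T * 1 := by
          refine mul_le_mul_of_nonneg_left ?_ hTpos.le
          rw [mul_inv_le_iff₀ hXτ, one_mul]; exact e3
      _ = T := mul_one T
  have h3' : Y ^ 8 * Q₁ ^ (-(1 / 8 : ℝ)) ≤ T := by
    have e1 : Y ^ 8 * Q₁ ^ (-(1 / 8 : ℝ)) = Q₁ ^ (-(1 / 40 : ℝ)) := by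
      rw [hYdef, ← Real.rpow_natCast, ← Real.rpow_mul hQpos.le, ← Real.rpow_add hQpos]
      norm_num
    rw [e1, hT]
    exact Real.rpow_le_rpow_of_exponent_le hQ1 (by norm_num)
  have h4' : Y ^ 8 * Q₁ ^ 2 * Real.exp (-(c₂ * Real.sqrt (Real.log (hbL X (hbTau ϖ X))))) ≤ T := by
    have e1 : Y ^ 8 * Q₁ ^ 2 = T * Q₁ ^ (337 / 160 : ℝ) := by
      rw [hYdef, ← Real.rpow_natCast, ← Real.rpow_mul hQpos.le, ← Real.rpow_natCast Q₁ 2,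
        ← Real.rpow_add hQpos, hT, ← Real.rpow_add hQpos]
      norm_num
    have e2 : Real.log (hbL X (hbTau ϖ X)) = hbTau ϖ X * Real.log X / 2 := by
      rw [hbL, Real.log_rpow hX0]; ring
    have e3 : Q₁ ^ (337 / 160 : ℝ) ≤
        Real.exp (c₂ * Real.sqrt (Real.log (hbL X (hbTau ϖ X)))) := by
      calc Q₁ ^ (337 / 160 : ℝ) ≤ Real.exp ((337 / 160) * Real.log X ^ (1 / 3 : ℝ)) :=
            hQpow _ (by norm_num)
        _ ≤ Real.exp (c₂ * Real.sqrt (Real.log (hbL X (hbTau ϖ X)))) := by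
            rw [e2]; exact Real.exp_le_exp.mpr hC
    have hE : 0 < Real.exp (c₂ * Real.sqrt (Real.log (hbL X (hbTau ϖ X)))) := Real.exp_pos _
    rw [e1, Real.exp_neg, mul_assoc]
    calc T * (Q₁ ^ (337 / 160 : ℝ) *
          (Real.exp (c₂ * Real.sqrt (Real.log (hbL X (hbTau ϖ X)))))⁻¹) ≤ T * 1 := by
          refine mul_le_mul_of_nonneg_left ?_ hTpos.le
          rw [mul_inv_le_iff₀ hE, one_mul]; exact e3
      _ = T := mul_one T
  -- assemble
  have hsum : Y ^ (-(1 / 2 : ℝ)) + Y ^ 30 * X ^ (-(hbTau ϖ X / 4)) + Y ^ 8 * Q₁ ^ (-(1 / 8 : ℝ)) +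
      Y ^ 8 * Q₁ ^ 2 * Real.exp (-(c₂ * Real.sqrt (Real.log (hbL X (hbTau ϖ X))))) ≤ 4 * T := by
    rw [h1]; linarith
  have hsum0 : 0 ≤ Y ^ (-(1 / 2 : ℝ)) + Y ^ 30 * X ^ (-(hbTau ϖ X / 4)) +
      Y ^ 8 * Q₁ ^ (-(1 / 8 : ℝ)) +
      Y ^ 8 * Q₁ ^ 2 * Real.exp (-(c₂ * Real.sqrt (Real.log (hbL X (hbTau ϖ X))))) := by
    positivity
  have hLc : 0 ≤ Real.log X ^ c := Real.rpow_nonneg hLpos.le _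
  have hC0 : C ≤ max C 0 := le_max_left _ _
  have hM0 : 0 ≤ max C 0 := le_max_right _ _
  refine hmain.trans ?_
  calc C * X ^ 2 * (Y ^ (-(1 / 2 : ℝ)) + Y ^ 30 * X ^ (-(hbTau ϖ X / 4)) +
          Y ^ 8 * Q₁ ^ (-(1 / 8 : ℝ)) +
          Y ^ 8 * Q₁ ^ 2 * Real.exp (-(c₂ * Real.sqrt (Real.log (hbL X (hbTau ϖ X)))))) *
        Real.log X ^ c
      ≤ max C 0 * X ^ 2 * (Y ^ (-(1 / 2 : ℝ)) + Y ^ 30 * X ^ (-(hbTau ϖ X / 4)) +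
          Y ^ 8 * Q₁ ^ (-(1 / 8 : ℝ)) +
          Y ^ 8 * Q₁ ^ 2 * Real.exp (-(c₂ * Real.sqrt (Real.log (hbL X (hbTau ϖ X)))))) *
        Real.log X ^ c :=
        mul_le_mul_of_nonneg_right (mul_le_mul_of_nonneg_right
          (mul_le_mul_of_nonneg_right hC0 (by positivity)) hsum0) hLc
    _ ≤ max C 0 * X ^ 2 * (4 * T) * Real.log X ^ c :=
        mul_le_mul_of_nonneg_right (mul_le_mul_of_nonneg_left hsum (by positivity)) hLc
    _ = 4 * max C 0 * X ^ 2 * Q₁ ^ (-(1 / 160 : ℝ)) * Real.log X ^ c := by rw [hT]; ring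

/-- **`h310` of `heathBrownMorozUniform_of_classLemmas`** (the class Type II estimate, (3.14) up to `d·Q₁`,
`d·Q₁ ≤ exp((log X)^{1/3})`) from the three Type II stubs: `class_310` with `Q₁ ≤ d·Q₁`. -/
theorem class_h310 :
    ∀ d a b : ℕ, 0 < d → a < d → b < d → Nat.Coprime (a ^ 3 + 2 * b ^ 3) d →
      ∀ ϖ : ℝ, 0 < ϖ → ϖ < 1 / 5 →
        ∃ c c₃ c₄ : ℝ, 0 < c₃ ∧ 0 < c₄ ∧ ∀ C₁ c₁ c₅ c₆ : ℝ, 0 < c₁ → 0 < c₅ → 0 < c₆ →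
          ∃ C X₀ : ℝ, ∀ X η Q₁ : ℝ, X₀ ≤ X → Real.exp (-Real.log X ^ (1 / 3 : ℝ)) ≤ η → η ≤ 1 →
            1 ≤ Q₁ → (d : ℝ) * Q₁ ≤ Real.exp (Real.log X ^ (1 / 3 : ℝ)) →
              (∀ (k' : ℕ) (m' : Fin k' → ℕ), CoreAdmissible (hbTau ϖ X) m' →
                Hyp314 X (hbTau ϖ X) m' ((d : ℝ) * Q₁) C₁ c₁ c₃ c₄) →
                ∀ (k : ℕ) (m : Fin k → ℕ), CoreAdmissible (hbTau ϖ X) m →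
                  ∀ cR : Ideal (𝓞 K) → ℝ, CSupport X (hbTau ϖ X) cR →
                    ∀ V : ℝ, c₅ * X ^ (1 + hbTau ϖ X) ≤ V → V ≤ c₆ * X ^ (3 / 2 - hbTau ϖ X) →
                      |bilin (classPairs X η d a b) pairIdeal cR
                          (fun S => if V < (Ideal.absNorm S : ℝ) ∧ (Ideal.absNorm S : ℝ) ≤ 2 * V then
                            fWeight X (hbTau ϖ X) m S else 0)| ≤
                        C * X ^ 2 * Q₁ ^ (-(1 / 160 : ℝ)) * Real.log X ^ c := by
  intro d a b hd _ha _hb _hadm ϖ hϖ0 hϖ5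
  obtain ⟨c, c₃, c₄, hc₃, hc₄, H⟩ := class_310 d a b hd ϖ hϖ0 hϖ5
  refine ⟨c, c₃, c₄, hc₃, hc₄, fun C₁ c₁ c₅ c₆ hc₁ hc₅ hc₆ => ?_⟩
  obtain ⟨C, X₀, HX⟩ := H C₁ c₁ c₅ c₆ hc₁ hc₅ hc₆
  refine ⟨C, X₀, fun X η Q₁ hX hη1 hη2 hQ1 hdQ hHyp k m hm cR hcR V hV1 hV2 => ?_⟩
  have hd1 : (1 : ℝ) ≤ d := Nat.one_le_cast.mpr hd
  have hQd : Q₁ ≤ (d : ℝ) * Q₁ := le_mul_of_one_le_left (by linarith) hd1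
  exact HX X η Q₁ hX hη1 hη2 hQ1 (hQd.trans hdQ) hHyp k m hm cR hcR V hV1 hV2


/-- **The crux modulo the class leading parts.** With the class Type II estimate `class_h310` proved, the
route crux `HeathBrownMorozUniform` follows from `h39` (class Lemma 3.9 = HBM04 Lemma 4.1) alone, by the
landed `heathBrownMorozUniform_of_twoClassLemmas` (p556968). Goldbach is not proved by this.
[cite: HeathBrownMoroz2004, Theorem 2] -/
theorem heathBrownMorozUniform_of_h39
    (h39 : ∀ d a b : ℕ, 0 < d → a < d → b < d → Nat.Coprime (a ^ 3 + 2 * b ^ 3) d →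
      ∀ σ₀ : ℝ, Tendsto singularProductPartial atTop (𝓝 σ₀) → ∀ ϖ : ℝ, 0 < ϖ → ϖ < 1 / 5 →
        ∃ c C X₀ : ℝ, ∀ X η : ℝ, X₀ ≤ X → Real.exp (-Real.log X ^ (1 / 3 : ℝ)) ≤ η → η ≤ 1 →
          ∀ (k : ℕ) (m : Fin k → ℕ), CoreAdmissible (hbTau ϖ X) m →
            ∀ cR : Ideal (𝓞 K) → ℝ, CSupport X (hbTau ϖ X) cR →
              |bilin (classPairs X η d a b) pairIdeal cR (eWeight X (hbTau ϖ X) m) -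
                  classKappa σ₀ X η d *
                    bilin (normWindow X η) (fun J => J) cR (dWeight X (hbTau ϖ X) m)| ≤
                C * (∏ i, (m i : ℝ))⁻¹ * η ^ (5 / 2 : ℝ) * X ^ 2 * Real.log X ^ c) :
    Summit.Parity.GeneralizedHardyLittlewood.Theses.GoldbachHeathBrownDispersion.HeathBrownMorozUniform :=
  heathBrownMorozUniform_of_twoClassLemmas h39 class_h310

end Summit.Parity.GeneralizedHardyLittlewood.Theorems.GoldbachHeathBrownDispersionHeathBrownMorozUniform

end
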